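import Summits.CriticalPhenomena.SAWScalingLimit.Theorems.SAWTotalPositivityBoundaryTP2Defs
import Summits.CriticalPhenomena.SAWScalingLimit.Theorems.SAWTotalPositivityBoundaryTP2Kernel
import Summits.CriticalPhenomena.SAWScalingLimit.Theorems.SAWTotalPositivityBoundaryTP2Symmetry
import Summits.CriticalPhenomena.SAWScalingLimit.Theorems.SAWTotalPositivityBoundaryTP2LadderRung
import Summits.CriticalPhenomena.SAWScalingLimit.Theorems.SAWTotalPositivityBoundaryTP2LadderKernelsInterior
import Summits.CriticalPhenomena.SAWScalingLimit.Theorems.EdgeOfPositivity.Negative.EdgeOfPositivityRectDomain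
import HarnessLib

/-!
# Crux `BoundaryTP2` (stmt-CriticalPhenomena-7115), line `Sketch`: three bottom sites and the top
site above the middle one on a ladder, crossing pairing vs adjacent pairing

Tool stub `stub_ladder_bbbt_over_adjacent` of the line's skeleton: on the ladder
`R_L = discreteDomainGraph (rectDomain L 1) 1` (sites `{0..L} × {0,1}`), for bottom sites
`(c₁,0), (c₂,0), (c₃,0)`, `c₁ < c₂ < c₃ ≤ L`, the top site `(c₂,1)` above the middle one (cyclic
boundary order `(c₁,0), (c₂,0), (c₃,0), (c₂,1)`), and every fugacity `0 ≤ x ≤ 1/2`, the crossing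
pairing weighs at most the adjacent one:

  `Z((c₁,0),(c₃,0)) Z((c₂,0),(c₂,1)) ≤ Z((c₁,0),(c₂,0)) Z((c₃,0),(c₂,1))`,  `Z = pathKernel R_L x`.

Proof. Write `E_k = Σ_{d<k} x^{2d+3}`, `P = 1 + x`, `M = 1 - x`, and for a column `c`
`a_c = P + E_c`, `a'_c = M - E_c`, `b_c = P + E_{L-c}`, `b'_c = M - E_{L-c}`. The landed kernels
(`stub_ladderKernels_interior`, `stub_ladderRung`, `pathKernel_comm`) have the rank-two forms
`Z((i,0),(j,0)) = x^{n+1}/2 · (a_i b_j P^n + a'_i b'_j M^n)`,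
`Z((j,0),(i,1)) = x^{n+1}/2 · (a_i b_j P^n - a'_i b'_j M^n)` for `i + n + 1 = j`
(`bbbtOver_kernel_same/_mixed'`), and the rung is `Z((c,0),(c,1)) = x + E_c + E_{L-c}`.
With `c₂ - c₁ = u + 1`, `c₃ - c₂ = m + 1`, `S₁₂ = Z((c₁,0),(c₂,0))`, `S₁₃ = Z((c₁,0),(c₃,0))`,
`Y = Z((c₃,0),(c₂,1))`, `R = x + E_{c₂} + E_{L-c₂}` one has the polynomial identity (`ring`; the
rung exceeds its rank-two value `½(a b/P - a' b'/M)` by `x E_{c₂} E_{L-c₂}/(PM)`)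

  `4PM (S₁₂ Y - S₁₃ R) + 4x E_{c₂} E_{L-c₂} S₁₃`
  `  = x^{u+m+2} [a₁ a'₂ P^{u+1} + a'₁ a₂ M^{u+1}] [b'₂ b₃ P^{m+1} - b₂ b'₃ M^{m+1}]`,

so it remains to bound the residual (`bbbtOver_resid`): using `E_k (1-x²) ≤ x³` (so
`0 ≤ E_k ≤ 4x³/3 ≤ 1/6`, `a', b' ≥ 0`, `a' P ≤ a M`, `b' P ≤ b M`, `M^k ≤ P^k`), the left bracket
is at least its main part `a₁ a'₂ P^{u+1} ≥ 0`, the right bracket is at least `P^m h₀ ≥ 0` with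
`h₀ = 2x(1-x²) - (2+2x²) E_{L-c₂}` (as `b'₂ b₃ P - b₂ b'₃ M - h₀ = E_{L-c₃} (2(1-x²) - 2x E_{L-c₂})`
is `≥ 0`), and `P² (a₁ b₃ P^k + a'₁ b'₃ M^k) ≤ a₁ b₃ P^k (P² + M²)` for the same-row form of
`S₁₃`; after cancelling the common factor `x^{u+m+2} a₁ P^{u+m+1}` the claim reduces to the scalar
inequality `2x E_{c₂} E_{L-c₂} b₃ (P² + M²) ≤ a'₂ h₀ P²` (`bbbtOver_scalar`), which follows from
`E ≤ 4x³/3` on `[0, 1/2]` (left side `≤ (400/27) x⁷`, right side `≥ (2/9) x P²`). All real forms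
are `≥ 0`, so the bound transfers to `ℝ≥0∞` (`ENNReal.ofReal_mul`, `ENNReal.ofReal_le_ofReal`).
-/

noncomputable section

namespace Summit.CriticalPhenomena.SAWScalingLimit.Theorems.BoundaryTP2

open Literature.Probability.LatticeModels Literature.Probability.RandomPlanarGeometry
open Summit.CriticalPhenomena.SAWScalingLimit.Theorems.EdgeOfPositivity.Negative
open scoped ENNReal

/-! ## The excursion sums `E_k = Σ_{d<k} x^{2d+3}` -/

/-- `E_k ≥ 0` for `x ≥ 0`. [folklore] -/
private theorem bbbtOver_E_nonneg {x : ℝ} (hx : 0 ≤ x) (k : ℕ) :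
    0 ≤ ∑ d ∈ Finset.range k, x ^ (2 * d + 3) :=
  Finset.sum_nonneg fun _ _ => pow_nonneg hx _

/-- Telescoping: `E_k (1 - x²) + x^{2k+3} = x³`. [folklore] -/
private theorem bbbtOver_E_telescope (x : ℝ) (k : ℕ) :
    (∑ d ∈ Finset.range k, x ^ (2 * d + 3)) * (1 - x ^ 2) + x ^ (2 * k + 3) = x ^ 3 := by
  -- adapted from `…BoundaryTP2LadderBbbtInnerAdjacent` (`ladderBbbtI_E_telescope`)
  induction k with
  | zero => simp
  | succ k ih =>
    rw [Finset.sum_range_succ]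
    linear_combination ih

/-- Geometric bound `E_k (1 - x²) ≤ x³` for `x ≥ 0`. [folklore] -/
private theorem bbbtOver_E_bound {x : ℝ} (hx : 0 ≤ x) (k : ℕ) :
    (∑ d ∈ Finset.range k, x ^ (2 * d + 3)) * (1 - x ^ 2) ≤ x ^ 3 := by
  linarith [bbbtOver_E_telescope x k, pow_nonneg hx (2 * k + 3)]

/-- For `0 ≤ x ≤ 1/2`, `0 ≤ E` and `E (1-x²) ≤ x³` one has `E ≤ 4x³/3` (as `1 - x² ≥ 3/4`).
[folklore] -/
private theorem bbbtOver_E_le {x E : ℝ} (hx0 : 0 ≤ x) (hx : x ≤ 1 / 2) (hE : 0 ≤ E)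
    (hEb : E * (1 - x ^ 2) ≤ x ^ 3) : E ≤ 4 / 3 * x ^ 3 := by
  have hx2 : x ^ 2 ≤ (1 / 2) ^ 2 := pow_le_pow_left₀ hx0 hx 2
  norm_num at hx2
  have h1 : E * (3 / 4) ≤ E * (1 - x ^ 2) := mul_le_mul_of_nonneg_left (by linarith) hE
  linarith

/-! ## Real inequalities in the rank-two variables -/

/-- **The scalar inequality.** For `0 ≤ x ≤ 1/2` and `e, f, g ≥ 0` with `e (1-x²), f (1-x²),
g (1-x²) ≤ x³`: `2x e f (1+x+g) (P² + M²) ≤ (1-x-e) (2x(1-x²) - (2+2x²) f) P²`. With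
`e, f, g ≤ 4x³/3 ≤ 1/6` the left side is at most `(400/27) x⁷` and the right side is at least
`(1/3)(2x/3) P²`, and `(400/27) x⁷ ≤ (2/9) x P²` on `[0, 1/2]`. [folklore] -/
private theorem bbbtOver_scalar {x e f g : ℝ} (hx0 : 0 ≤ x) (hx : x ≤ 1 / 2) (he : 0 ≤ e)
    (hf : 0 ≤ f) (hg : 0 ≤ g) (heb : e * (1 - x ^ 2) ≤ x ^ 3) (hfb : f * (1 - x ^ 2) ≤ x ^ 3)
    (hgb : g * (1 - x ^ 2) ≤ x ^ 3) :
    2 * x * e * f * (1 + x + g) * ((1 + x) ^ 2 + (1 - x) ^ 2) ≤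
      (1 - x - e) * (2 * x * (1 - x ^ 2) - (2 + 2 * x ^ 2) * f) * (1 + x) ^ 2 := by
  have he' := bbbtOver_E_le hx0 hx he heb
  have hf' := bbbtOver_E_le hx0 hx hf hfb
  have hg' := bbbtOver_E_le hx0 hx hg hgb
  have hx2 : x ^ 2 ≤ (1 / 2) ^ 2 := pow_le_pow_left₀ hx0 hx 2
  have hx3 : x ^ 3 ≤ (1 / 2) ^ 3 := pow_le_pow_left₀ hx0 hx 3
  have hx4 : x ^ 4 ≤ (1 / 2) ^ 4 := pow_le_pow_left₀ hx0 hx 4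
  have hx5 : x ^ 5 ≤ (1 / 2) ^ 5 := pow_le_pow_left₀ hx0 hx 5
  norm_num at hx2 hx3 hx4 hx5
  -- upper bound of the left side
  have hef : e * f ≤ (4 / 3 * x ^ 3) * (4 / 3 * x ^ 3) := mul_le_mul he' hf' hf (by positivity)
  have hL : 2 * x * e * f * (1 + x + g) * ((1 + x) ^ 2 + (1 - x) ^ 2) ≤ 400 / 27 * x ^ 7 := by
    have h1 : 1 + x + g ≤ 5 / 3 := by linarith
    have h2 : (1 + x) ^ 2 + (1 - x) ^ 2 ≤ 5 / 2 := by nlinarith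
    calc 2 * x * e * f * (1 + x + g) * ((1 + x) ^ 2 + (1 - x) ^ 2)
        = 2 * x * ((e * f) * ((1 + x + g) * ((1 + x) ^ 2 + (1 - x) ^ 2))) := by ring
      _ ≤ 2 * x * (((4 / 3 * x ^ 3) * (4 / 3 * x ^ 3)) * (5 / 3 * (5 / 2))) := by
          refine mul_le_mul_of_nonneg_left ?_ (by linarith)
          exact mul_le_mul hef (mul_le_mul h1 h2 (by positivity) (by linarith))
            (by positivity) (by positivity)
      _ = 400 / 27 * x ^ 7 := by ring
  -- lower bound of the right side
  have hR : 2 / 9 * x * (1 + x) ^ 2 ≤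
      (1 - x - e) * (2 * x * (1 - x ^ 2) - (2 + 2 * x ^ 2) * f) * (1 + x) ^ 2 := by
    have f1 : 1 / 3 ≤ 1 - x - e := by linarith
    have f2 : 2 / 3 * x ≤ 2 * x * (1 - x ^ 2) - (2 + 2 * x ^ 2) * f := by
      have t : (2 + 2 * x ^ 2) * f ≤ (2 + 2 * x ^ 2) * (4 / 3 * x ^ 3) :=
        mul_le_mul_of_nonneg_left hf' (by positivity)
      have t2 : x ^ 3 = x * x ^ 2 := by ring
      have t3 : x ^ 5 = x * x ^ 4 := by ring
      nlinarith [mul_le_mul_of_nonneg_left hx2 hx0, mul_le_mul_of_nonneg_left hx4 hx0]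
    have f12 : 1 / 3 * (2 / 3 * x) ≤ (1 - x - e) * (2 * x * (1 - x ^ 2) - (2 + 2 * x ^ 2) * f) :=
      mul_le_mul f1 f2 (by positivity) (by linarith)
    calc 2 / 9 * x * (1 + x) ^ 2 = 1 / 3 * (2 / 3 * x) * (1 + x) ^ 2 := by ring
      _ ≤ _ := mul_le_mul_of_nonneg_right f12 (by positivity)
  -- comparison of the two scalar bounds
  have hM : 400 / 27 * x ^ 7 ≤ 2 / 9 * x * (1 + x) ^ 2 := by
    have h6 : x ^ 7 ≤ x * (1 / 32) * x :=
      calc x ^ 7 = x * x ^ 5 * x := by ring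
        _ ≤ x * (1 / 32) * x :=
            mul_le_mul_of_nonneg_right (mul_le_mul_of_nonneg_left hx5 hx0) hx0
    nlinarith [mul_nonneg hx0 hx0]
  linarith
set_option maxHeartbeats 800000 in -- buildfix 2026-08-19 (class ii): >200k in hub lake build
/-- **The residual inequality.** In the rank-two variables `e₁ = E_{c₁}`, `e₂ = E_{c₂}`,
`f₂ = E_{L-c₂}`, `f₃ = E_{L-c₃}` (all `≥ 0` with `E (1-x²) ≤ x³`) and spans `c₂ - c₁ = u + 1`,
`c₃ - c₂ = m + 1`:
`4x e₂ f₂ S₁₃ ≤ x^{u+m+2} [a₁ a'₂ P^{u+1} + a'₁ a₂ M^{u+1}] [b'₂ b₃ P^{m+1} - b₂ b'₃ M^{m+1}]`,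
`S₁₃ = x^{u+m+2}/2 (a₁ b₃ P^{u+m+1} + a'₁ b'₃ M^{u+m+1})` the same-row form. The left bracket is at
least its main part `a₁ a'₂ P^{u+1}`, the right bracket at least `P^m h₀`,
`h₀ = 2x(1-x²) - (2+2x²) f₂ ≥ 0`, and `P² S₁₃ ≤ x^{u+m+2}/2 · a₁ b₃ P^{u+m+1} (P² + M²)`; the common
factor `x^{u+m+2} a₁ P^{u+m+1}` cancels and `bbbtOver_scalar` concludes. [folklore] -/
private theorem bbbtOver_resid {x e₁ e₂ f₂ f₃ : ℝ} (u m : ℕ) (hx0 : 0 ≤ x) (hx : x ≤ 1 / 2)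
    (he₁ : 0 ≤ e₁) (he₂ : 0 ≤ e₂) (hf₂ : 0 ≤ f₂) (hf₃ : 0 ≤ f₃) (he₁b : e₁ * (1 - x ^ 2) ≤ x ^ 3)
    (he₂b : e₂ * (1 - x ^ 2) ≤ x ^ 3) (hf₂b : f₂ * (1 - x ^ 2) ≤ x ^ 3)
    (hf₃b : f₃ * (1 - x ^ 2) ≤ x ^ 3) :
    4 * x * e₂ * f₂ * (x ^ (u + m + 2) / 2 * ((1 + x + e₁) * (1 + x + f₃) * (1 + x) ^ (u + m + 1) +
        (1 - x - e₁) * (1 - x - f₃) * (1 - x) ^ (u + m + 1))) ≤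
      x ^ (u + m + 2) *
        (((1 + x + e₁) * (1 - x - e₂) * (1 + x) ^ (u + 1) +
            (1 - x - e₁) * (1 + x + e₂) * (1 - x) ^ (u + 1)) *
          ((1 - x - f₂) * (1 + x + f₃) * (1 + x) ^ (m + 1) -
            (1 + x + f₂) * (1 - x - f₃) * (1 - x) ^ (m + 1))) := by
  have he₁' := bbbtOver_E_le hx0 hx he₁ he₁b
  have he₂' := bbbtOver_E_le hx0 hx he₂ he₂b
  have hf₂' := bbbtOver_E_le hx0 hx hf₂ hf₂b
  have hf₃' := bbbtOver_E_le hx0 hx hf₃ hf₃b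
  have hx2 : x ^ 2 ≤ (1 / 2) ^ 2 := pow_le_pow_left₀ hx0 hx 2
  have hx3 : x ^ 3 ≤ (1 / 2) ^ 3 := pow_le_pow_left₀ hx0 hx 3
  have hx4 : x ^ 4 ≤ (1 / 2) ^ 4 := pow_le_pow_left₀ hx0 hx 4
  norm_num at hx2 hx3 hx4
  have hP : 0 ≤ 1 + x := by linarith
  have hM : 0 ≤ 1 - x := by linarith
  have hMP : ∀ k : ℕ, (1 - x) ^ k ≤ (1 + x) ^ k := fun k => pow_le_pow_left₀ hM (by linarith) k
  have ha₁' : 0 ≤ 1 - x - e₁ := by linarith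
  have ha₂' : 0 ≤ 1 - x - e₂ := by linarith
  have hb₃' : 0 ≤ 1 - x - f₃ := by linarith
  -- the scalar inequality
  have hsc := bbbtOver_scalar hx0 hx he₂ hf₂ hf₃ he₂b hf₂b hf₃b
  -- (a) the left bracket dominates its main part
  have hA : (1 + x + e₁) * (1 - x - e₂) * (1 + x) ^ (u + 1) ≤
      (1 + x + e₁) * (1 - x - e₂) * (1 + x) ^ (u + 1) +
        (1 - x - e₁) * (1 + x + e₂) * (1 - x) ^ (u + 1) :=
    le_add_of_nonneg_right (mul_nonneg (mul_nonneg ha₁' (by linarith)) (pow_nonneg hM _))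
  have hA0 : 0 ≤ (1 + x + e₁) * (1 - x - e₂) * (1 + x) ^ (u + 1) :=
    mul_nonneg (mul_nonneg (by linarith) ha₂') (pow_nonneg hP _)
  -- (b) the right bracket dominates `P^m · h₀`, `h₀ = 2x(1-x²) - (2+2x²) f₂ ≥ 0`
  have h0nn : 0 ≤ 2 * x * (1 - x ^ 2) - (2 + 2 * x ^ 2) * f₂ := by
    have t : (2 + 2 * x ^ 2) * f₂ ≤ (2 + 2 * x ^ 2) * (4 / 3 * x ^ 3) :=
      mul_le_mul_of_nonneg_left hf₂' (by positivity)
    have t2 : x ^ 3 = x * x ^ 2 := by ring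
    have t3 : x ^ 5 = x * x ^ 4 := by ring
    nlinarith [mul_le_mul_of_nonneg_left hx2 hx0, mul_le_mul_of_nonneg_left hx4 hx0]
  have hB : (1 + x) ^ m * (2 * x * (1 - x ^ 2) - (2 + 2 * x ^ 2) * f₂) ≤
      (1 - x - f₂) * (1 + x + f₃) * (1 + x) ^ (m + 1) -
        (1 + x + f₂) * (1 - x - f₃) * (1 - x) ^ (m + 1) := by
    -- `M^{m+1} ≤ M P^m`
    have t1 : (1 + x + f₂) * (1 - x - f₃) * (1 - x) ^ (m + 1) ≤
        (1 + x + f₂) * (1 - x - f₃) * ((1 - x) * (1 + x) ^ m) := by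
      rw [pow_succ']
      exact mul_le_mul_of_nonneg_left (mul_le_mul_of_nonneg_left (hMP m) hM)
        (mul_nonneg (by linarith) hb₃')
    -- the orientation function `b'₂ b₃ P - b₂ b'₃ M = h₀ + f₃ (2(1-x²) - 2x f₂) ≥ h₀`
    have t2 : (1 + x) ^ m * (2 * x * (1 - x ^ 2) - (2 + 2 * x ^ 2) * f₂) ≤
        (1 - x - f₂) * (1 + x + f₃) * (1 + x) ^ (m + 1) -
          (1 + x + f₂) * (1 - x - f₃) * ((1 - x) * (1 + x) ^ m) := by
      have e : (1 - x - f₂) * (1 + x + f₃) * (1 + x) ^ (m + 1) -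
          (1 + x + f₂) * (1 - x - f₃) * ((1 - x) * (1 + x) ^ m) -
          (1 + x) ^ m * (2 * x * (1 - x ^ 2) - (2 + 2 * x ^ 2) * f₂) =
          (1 + x) ^ m * (f₃ * (2 * (1 - x ^ 2) - 2 * x * f₂)) := by ring
      have hpos : 0 ≤ (1 + x) ^ m * (f₃ * (2 * (1 - x ^ 2) - 2 * x * f₂)) :=
        mul_nonneg (pow_nonneg hP m) (mul_nonneg hf₃ (by nlinarith))
      linarith
    linarith
  have hB0 : 0 ≤ (1 + x) ^ m * (2 * x * (1 - x ^ 2) - (2 + 2 * x ^ 2) * f₂) :=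
    mul_nonneg (pow_nonneg hP m) h0nn
  -- (c) the same-row form is at most its main part times `(P² + M²)/P²`
  have hC : (1 + x) ^ 2 * ((1 + x + e₁) * (1 + x + f₃) * (1 + x) ^ (u + m + 1) +
        (1 - x - e₁) * (1 - x - f₃) * (1 - x) ^ (u + m + 1)) ≤
      (1 + x + e₁) * (1 + x + f₃) * (1 + x) ^ (u + m + 1) * ((1 + x) ^ 2 + (1 - x) ^ 2) := by
    have s1 : (1 - x - e₁) * (1 + x) ≤ (1 + x + e₁) * (1 - x) := by nlinarith
    have s2 : (1 - x - f₃) * (1 + x) ≤ (1 + x + f₃) * (1 - x) := by nlinarith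
    have s12 : (1 - x - e₁) * (1 + x) * ((1 - x - f₃) * (1 + x)) ≤
        (1 + x + e₁) * (1 - x) * ((1 + x + f₃) * (1 - x)) :=
      mul_le_mul s1 s2 (mul_nonneg hb₃' hP) (mul_nonneg (by linarith) hM)
    have s3 : (1 - x - e₁) * (1 + x) * ((1 - x - f₃) * (1 + x)) * (1 - x) ^ (u + m + 1) ≤
        (1 + x + e₁) * (1 - x) * ((1 + x + f₃) * (1 - x)) * (1 + x) ^ (u + m + 1) :=
      mul_le_mul s12 (hMP _) (pow_nonneg hM _)
        (mul_nonneg (mul_nonneg (by linarith) hM) (mul_nonneg (by linarith) hM))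
    have e : (1 + x + e₁) * (1 + x + f₃) * (1 + x) ^ (u + m + 1) * ((1 + x) ^ 2 + (1 - x) ^ 2) -
        (1 + x) ^ 2 * ((1 + x + e₁) * (1 + x + f₃) * (1 + x) ^ (u + m + 1) +
          (1 - x - e₁) * (1 - x - f₃) * (1 - x) ^ (u + m + 1)) =
        (1 + x + e₁) * (1 - x) * ((1 + x + f₃) * (1 - x)) * (1 + x) ^ (u + m + 1) -
          (1 - x - e₁) * (1 + x) * ((1 - x - f₃) * (1 + x)) * (1 - x) ^ (u + m + 1) := by ring
    linarith
  -- (d) assemble: multiply through by `P² > 0` and chain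
  have hP2 : 0 < (1 + x) ^ 2 := by positivity
  have hxk : 0 ≤ x ^ (u + m + 2) := pow_nonneg hx0 _
  have hcommon : 0 ≤ x ^ (u + m + 2) * ((1 + x + e₁) * (1 + x) ^ (u + m + 1)) :=
    mul_nonneg hxk (mul_nonneg (by linarith) (pow_nonneg hP _))
  rw [← sub_nonneg]
  refine le_of_mul_le_mul_left ?_ hP2
  rw [mul_zero, mul_sub, sub_nonneg]
  have hAB : (1 + x + e₁) * (1 - x - e₂) * (1 + x) ^ (u + 1) *
        ((1 + x) ^ m * (2 * x * (1 - x ^ 2) - (2 + 2 * x ^ 2) * f₂)) ≤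
      ((1 + x + e₁) * (1 - x - e₂) * (1 + x) ^ (u + 1) +
          (1 - x - e₁) * (1 + x + e₂) * (1 - x) ^ (u + 1)) *
        ((1 - x - f₂) * (1 + x + f₃) * (1 + x) ^ (m + 1) -
          (1 + x + f₂) * (1 - x - f₃) * (1 - x) ^ (m + 1)) :=
    mul_le_mul hA hB hB0 (hA0.trans hA)
  calc (1 + x) ^ 2 * (4 * x * e₂ * f₂ * (x ^ (u + m + 2) / 2 *
          ((1 + x + e₁) * (1 + x + f₃) * (1 + x) ^ (u + m + 1) +
            (1 - x - e₁) * (1 - x - f₃) * (1 - x) ^ (u + m + 1))))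
      = 2 * x * e₂ * f₂ * x ^ (u + m + 2) * ((1 + x) ^ 2 *
          ((1 + x + e₁) * (1 + x + f₃) * (1 + x) ^ (u + m + 1) +
            (1 - x - e₁) * (1 - x - f₃) * (1 - x) ^ (u + m + 1))) := by ring
    _ ≤ 2 * x * e₂ * f₂ * x ^ (u + m + 2) *
          ((1 + x + e₁) * (1 + x + f₃) * (1 + x) ^ (u + m + 1) * ((1 + x) ^ 2 + (1 - x) ^ 2)) :=
        mul_le_mul_of_nonneg_left hC (by positivity)
    _ = x ^ (u + m + 2) * ((1 + x + e₁) * (1 + x) ^ (u + m + 1)) *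
          (2 * x * e₂ * f₂ * (1 + x + f₃) * ((1 + x) ^ 2 + (1 - x) ^ 2)) := by ring
    _ ≤ x ^ (u + m + 2) * ((1 + x + e₁) * (1 + x) ^ (u + m + 1)) *
          ((1 - x - e₂) * (2 * x * (1 - x ^ 2) - (2 + 2 * x ^ 2) * f₂) * (1 + x) ^ 2) :=
        mul_le_mul_of_nonneg_left hsc hcommon
    _ = (1 + x) ^ 2 * (x ^ (u + m + 2) * ((1 + x + e₁) * (1 - x - e₂) * (1 + x) ^ (u + 1) *
          ((1 + x) ^ m * (2 * x * (1 - x ^ 2) - (2 + 2 * x ^ 2) * f₂)))) := by ring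
    _ ≤ (1 + x) ^ 2 * (x ^ (u + m + 2) *
          (((1 + x + e₁) * (1 - x - e₂) * (1 + x) ^ (u + 1) +
              (1 - x - e₁) * (1 + x + e₂) * (1 - x) ^ (u + 1)) *
            ((1 - x - f₂) * (1 + x + f₃) * (1 + x) ^ (m + 1) -
              (1 + x + f₂) * (1 - x - f₃) * (1 - x) ^ (m + 1)))) :=
        mul_le_mul_of_nonneg_left (mul_le_mul_of_nonneg_left hAB hxk) hP2.le

/-- **The real inequality behind the stub**, `S₁₃ R ≤ S₁₂ Y` in the rank-two variables: by the
polynomial identity `4PM (S₁₂ Y - S₁₃ R) = x^{u+m+2} [a₁ a'₂ P^{u+1} + a'₁ a₂ M^{u+1}]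
[b'₂ b₃ P^{m+1} - b₂ b'₃ M^{m+1}] - 4x e₂ f₂ S₁₃` (`ring`), the residual inequality
`bbbtOver_resid`, and `4PM > 0`. [folklore] -/
private theorem bbbtOver_real {x e₁ e₂ f₂ f₃ : ℝ} (u m : ℕ) (hx0 : 0 ≤ x) (hx : x ≤ 1 / 2)
    (he₁ : 0 ≤ e₁) (he₂ : 0 ≤ e₂) (hf₂ : 0 ≤ f₂) (hf₃ : 0 ≤ f₃) (he₁b : e₁ * (1 - x ^ 2) ≤ x ^ 3)
    (he₂b : e₂ * (1 - x ^ 2) ≤ x ^ 3) (hf₂b : f₂ * (1 - x ^ 2) ≤ x ^ 3)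
    (hf₃b : f₃ * (1 - x ^ 2) ≤ x ^ 3) :
    x ^ (u + m + 2) / 2 * ((1 + x + e₁) * (1 + x + f₃) * (1 + x) ^ (u + m + 1) +
          (1 - x - e₁) * (1 - x - f₃) * (1 - x) ^ (u + m + 1)) *
        (x + e₂ + f₂) ≤
      x ^ (u + 1) / 2 * ((1 + x + e₁) * (1 + x + f₂) * (1 + x) ^ u +
          (1 - x - e₁) * (1 - x - f₂) * (1 - x) ^ u) *
        (x ^ (m + 1) / 2 * ((1 + x + e₂) * (1 + x + f₃) * (1 + x) ^ m -
          (1 - x - e₂) * (1 - x - f₃) * (1 - x) ^ m)) := by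
  have hres := bbbtOver_resid u m hx0 hx he₁ he₂ hf₂ hf₃ he₁b he₂b hf₂b hf₃b
  have hPM : 0 < 4 * (1 + x) * (1 - x) := by nlinarith
  rw [← sub_nonneg]
  refine le_of_mul_le_mul_left ?_ hPM
  rw [mul_zero]
  have key : 4 * (1 + x) * (1 - x) *
      (x ^ (u + 1) / 2 * ((1 + x + e₁) * (1 + x + f₂) * (1 + x) ^ u +
          (1 - x - e₁) * (1 - x - f₂) * (1 - x) ^ u) *
        (x ^ (m + 1) / 2 * ((1 + x + e₂) * (1 + x + f₃) * (1 + x) ^ m -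
          (1 - x - e₂) * (1 - x - f₃) * (1 - x) ^ m)) -
      x ^ (u + m + 2) / 2 * ((1 + x + e₁) * (1 + x + f₃) * (1 + x) ^ (u + m + 1) +
          (1 - x - e₁) * (1 - x - f₃) * (1 - x) ^ (u + m + 1)) *
        (x + e₂ + f₂)) =
      x ^ (u + m + 2) *
        (((1 + x + e₁) * (1 - x - e₂) * (1 + x) ^ (u + 1) +
            (1 - x - e₁) * (1 + x + e₂) * (1 - x) ^ (u + 1)) *
          ((1 - x - f₂) * (1 + x + f₃) * (1 + x) ^ (m + 1) -
            (1 + x + f₂) * (1 - x - f₃) * (1 - x) ^ (m + 1))) -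
      4 * x * e₂ * f₂ * (x ^ (u + m + 2) / 2 *
        ((1 + x + e₁) * (1 + x + f₃) * (1 + x) ^ (u + m + 1) +
          (1 - x - e₁) * (1 - x - f₃) * (1 - x) ^ (u + m + 1))) := by
    ring
  rw [key]
  linarith

/-- The real form of a same-row kernel is nonnegative (`0 ≤ x ≤ 1/2`, `e, f ≥ 0` with
`e (1-x²), f (1-x²) ≤ x³`, so that `1 - x - e, 1 - x - f ≥ 0`). [folklore] -/
private theorem bbbtOver_same_nonneg {x e f : ℝ} (k : ℕ) (hx0 : 0 ≤ x) (hx : x ≤ 1 / 2)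
    (he : 0 ≤ e) (hf : 0 ≤ f) (heb : e * (1 - x ^ 2) ≤ x ^ 3) (hfb : f * (1 - x ^ 2) ≤ x ^ 3) :
    0 ≤ x ^ (k + 1) / 2 * ((1 + x + e) * (1 + x + f) * (1 + x) ^ k +
      (1 - x - e) * (1 - x - f) * (1 - x) ^ k) := by
  have he' := bbbtOver_E_le hx0 hx he heb
  have hf' := bbbtOver_E_le hx0 hx hf hfb
  have hx3 : x ^ 3 ≤ (1 / 2) ^ 3 := pow_le_pow_left₀ hx0 hx 3
  norm_num at hx3
  have ha : 0 ≤ 1 - x - e := by linarith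
  have hb : 0 ≤ 1 - x - f := by linarith
  exact mul_nonneg (by positivity) (add_nonneg (by positivity)
    (mul_nonneg (mul_nonneg ha hb) (pow_nonneg (by linarith) k)))

/-! ## The rank-two form of the ladder kernels -/

/-- Bottom-row kernels of the ladder `{0..L}×{0,1}` in rank-two form: for `i + n + 1 = j ≤ L` and
`x ≥ 0`, `Z_{R_L}((i,0),(j,0)) = x^{n+1}/2 · (a_i b_j (1+x)^n + a'_i b'_j (1-x)^n)` with
`a_i = 1+x+E_i`, `a'_i = 1-x-E_i`, `b_j = 1+x+E_{L-j}`, `b'_j = 1-x-E_{L-j}` (a regrouping of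
`stub_ladderKernels_interior`). [folklore] -/
private theorem bbbtOver_kernel_same (L i j n : ℕ) (hn : i + n + 1 = j) (hjL : j ≤ L) {x : ℝ}
    (hx : 0 ≤ x) :
    pathKernel (discreteDomainGraph (rectDomain L 1) 1) x (st i 0) (st j 0) =
      ENNReal.ofReal (x ^ (n + 1) / 2 *
        ((1 + x + ∑ d ∈ Finset.range i, x ^ (2 * d + 3)) *
              (1 + x + ∑ d ∈ Finset.range (L - j), x ^ (2 * d + 3)) * (1 + x) ^ n +
          (1 - x - ∑ d ∈ Finset.range i, x ^ (2 * d + 3)) *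
              (1 - x - ∑ d ∈ Finset.range (L - j), x ^ (2 * d + 3)) * (1 - x) ^ n)) := by
  -- adapted from `ladderBbbtI_kernel_same` in `…BoundaryTP2LadderBbbtInnerAdjacent`
  rw [stub_ladderKernels_interior L i j (by omega) hjL hx 0 0 (Or.inl rfl) (Or.inl rfl),
    if_pos rfl]
  congr 1
  subst hn
  have e1 : i + n + 1 - i = n + 1 := by omega
  have e2 : n + 1 - 1 = n := rfl
  rw [e1, e2]
  ring

/-- Top-to-bottom kernels of the ladder `{0..L}×{0,1}` in rank-two form: for `i + n + 1 = j ≤ L`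
and `x ≥ 0`, `Z_{R_L}((j,0),(i,1)) = Z_{R_L}((i,1),(j,0)) = x^{n+1}/2 · (a_i b_j (1+x)^n -
a'_i b'_j (1-x)^n)` (reversal `pathKernel_comm`, then `stub_ladderKernels_interior` with rows
`r = 1 ≠ 0 = s`). [folklore] -/
private theorem bbbtOver_kernel_mixed' (L i j n : ℕ) (hn : i + n + 1 = j) (hjL : j ≤ L) {x : ℝ}
    (hx : 0 ≤ x) :
    pathKernel (discreteDomainGraph (rectDomain L 1) 1) x (st j 0) (st i 1) =
      ENNReal.ofReal (x ^ (n + 1) / 2 *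
        ((1 + x + ∑ d ∈ Finset.range i, x ^ (2 * d + 3)) *
              (1 + x + ∑ d ∈ Finset.range (L - j), x ^ (2 * d + 3)) * (1 + x) ^ n -
          (1 - x - ∑ d ∈ Finset.range i, x ^ (2 * d + 3)) *
              (1 - x - ∑ d ∈ Finset.range (L - j), x ^ (2 * d + 3)) * (1 - x) ^ n)) := by
  -- adapted from `ladderBbbtI_kernel_mixed'` in `…BoundaryTP2LadderBbbtInnerAdjacent`
  rw [pathKernel_comm, stub_ladderKernels_interior L i j (by omega) hjL hx 1 0 (Or.inr rfl)
    (Or.inl rfl), if_neg (by norm_num : (1 : ℤ) ≠ 0)]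
  congr 1
  subst hn
  have e1 : i + n + 1 - i = n + 1 := by omega
  have e2 : n + 1 - 1 = n := rfl
  rw [e1, e2]
  ring

/-! ## The stub -/

/-- **Tool stub `stub_ladder_bbbt_over_adjacent`.** On the ladder `{0..L}×{0,1}`, for three bottom
sites `c₁ < c₂ < c₃ ≤ L` and the top site `(c₂,1)` above the middle one (cyclic order
`(c₁,0),(c₂,0),(c₃,0),(c₂,1)`) and `0 ≤ x ≤ 1/2`, the crossing pairing weighs at most the
adjacent one: `Z((c₁,0),(c₃,0)) Z((c₂,0),(c₂,1)) ≤ Z((c₁,0),(c₂,0)) Z((c₃,0),(c₂,1))`.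
Mechanism: in the rank-two form of the kernels the difference `S₁₂ Y - S₁₃ R` is, up to the
positive factor `4PM`, a product of two signed cross products minus the rung defect
`4x E_{c₂} E_{L-c₂} S₁₃`, and the defect is dominated (`bbbtOver_real`, `bbbtOver_resid`,
`bbbtOver_scalar`; `E_k (1-x²) ≤ x³`). [folklore] -/
theorem stub_ladder_bbbt_over_adjacent (L : ℕ) {c₁ c₂ c₃ : ℕ} (h₁₂ : c₁ < c₂) (h₂₃ : c₂ < c₃)
    (h₃ : c₃ ≤ L) {x : ℝ} (hx0 : 0 ≤ x) (hx : x ≤ 1 / 2) :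
    pathKernel (discreteDomainGraph (rectDomain L 1) 1) x (st c₁ 0) (st c₃ 0) *
        pathKernel (discreteDomainGraph (rectDomain L 1) 1) x (st c₂ 0) (st c₂ 1) ≤
      pathKernel (discreteDomainGraph (rectDomain L 1) 1) x (st c₁ 0) (st c₂ 0) *
        pathKernel (discreteDomainGraph (rectDomain L 1) 1) x (st c₃ 0) (st c₂ 1) := by
  obtain ⟨u, hu⟩ : ∃ u, c₁ + u + 1 = c₂ := ⟨c₂ - c₁ - 1, by omega⟩
  obtain ⟨m, hm⟩ : ∃ m, c₂ + m + 1 = c₃ := ⟨c₃ - c₂ - 1, by omega⟩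
  have hE : ∀ k : ℕ, 0 ≤ ∑ d ∈ Finset.range k, x ^ (2 * d + 3) := bbbtOver_E_nonneg hx0
  have hEb : ∀ k : ℕ, (∑ d ∈ Finset.range k, x ^ (2 * d + 3)) * (1 - x ^ 2) ≤ x ^ 3 :=
    bbbtOver_E_bound hx0
  rw [bbbtOver_kernel_same L c₁ c₃ (u + m + 1) (by omega) h₃ hx0,
    stub_ladderRung L c₂ (by omega) hx0, bbbtOver_kernel_same L c₁ c₂ u hu (by omega) hx0,
    bbbtOver_kernel_mixed' L c₂ c₃ m hm h₃ hx0,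
    ← ENNReal.ofReal_mul
      (bbbtOver_same_nonneg (u + m + 1) hx0 hx (hE c₁) (hE (L - c₃)) (hEb c₁) (hEb (L - c₃))),
    ← ENNReal.ofReal_mul
      (bbbtOver_same_nonneg u hx0 hx (hE c₁) (hE (L - c₂)) (hEb c₁) (hEb (L - c₂)))]
  exact ENNReal.ofReal_le_ofReal (bbbtOver_real u m hx0 hx (hE c₁) (hE c₂) (hE (L - c₂))
    (hE (L - c₃)) (hEb c₁) (hEb c₂) (hEb (L - c₂)) (hEb (L - c₃)))

end Summit.CriticalPhenomena.SAWScalingLimit.Theorems.BoundaryTP2
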